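import Mathlib
import Summits.Ventures.PercRepro2.RootBridgeTheorem
import Summits.Ventures.PercRepro2.RootCutStates

/-!
# The cut vertex at a root, II: the class, the side closure and the states of the support (blind
cell PercRepro2, p3 g0, 2026-08-25; `proofs/P3-BRIDGE.md` §8)

CLASS (`CutAtRoot`): the root `a₁` is a cut vertex of the support graph `z ∪ F` separating the side
`VL ∋ o, b` from the side `VH ∋ a₂, a₃` (every open edge lies within one side, the sides meet only
in `a₁`, no typed edge lies within both).  Side restrictions `withinRestr` and the closure lemmas
`conn_side` / `conn_cross` (a path between the sides passes through `a₁`); on the support every copy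
has the root-bridge state with the bridge bit constantly `true` (`st_eq_cutSt`), with the `h`-state
`hstC` read off the `h`-side restriction.  The factorisation and the theorem are in
`RootCutTheorem.lean`.  Own work; standard axioms.
-/

namespace Summit.Ventures.PercRepro2

open UnionCluster

namespace CovForm

namespace RootBridge

open OneTyped TypedA3 Untouched TypedFactor Separated

/-! ## Side restrictions and the closure lemmas at a cut vertex -/

section Sides

open Classical

variable {V : Type*} {E : Type*}
variable (ends : E → Sym2 V)

/-- A configuration restricted to the edges within a vertex set `W` (the others closed). -/
noncomputable def withinRestr (W : Set V) (x : Config E) : Config E :=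
  fun e => if e ∈ within ends W then x e else false

/-- The restriction is below the configuration. -/
lemma withinRestr_le (W : Set V) (x : Config E) : withinRestr ends W x ≤ x := by
  intro e
  unfold withinRestr
  split_ifs <;> simp

/-- Both ends of an edge within `W` lie in `W`. -/
lemma ends_mem_of_within {W : Set V} {e : E} {t t' : V} (he : e ∈ within ends W)
    (hends : ends e = s(t, t')) : t ∈ W ∧ t' ∈ W := by
  obtain ⟨p, hp, q, hq, hpq⟩ := he
  rw [hends, Sym2.eq_iff] at hpq
  rcases hpq with ⟨rfl, rfl⟩ | ⟨rfl, rfl⟩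
  · exact ⟨hp, hq⟩
  · exact ⟨hq, hp⟩

/-- Connections of the restriction stay inside `W`. -/
lemma mem_of_conn_withinRestr {W : Set V} {x : Config E} {r t : V} (hr : r ∈ W)
    (h : Conn ends (withinRestr ends W x) r t) : t ∈ W := by
  refine mem_of_conn_of_closed (ends := ends) (ω := withinRestr ends W x) ?_ hr h
  intro p _ q hpq
  obtain ⟨_, e, he, hends⟩ := openGraph_adj.1 hpq
  have hw : e ∈ within ends W := by
    by_contra hne
    simp [withinRestr, hne] at he
  exact (ends_mem_of_within ends hw hends).2

/-- **Side closure**: if every open edge lies within `W` or within `W'`, the sides meeting only in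
`a₁`, then for `r, u ∈ W` the connection `r ↔ u` is realised inside `W`. -/
theorem conn_side {W W' : Set V} {a₁ : V} {x : Config E}
    (hx : ∀ e, x e = true → e ∈ within ends W ∨ e ∈ within ends W')
    (hcap : ∀ t, t ∈ W → t ∈ W' → t = a₁) {r u : V} (hr : r ∈ W) (hu : u ∈ W) :
    Conn ends x r u ↔ Conn ends (withinRestr ends W x) r u := by
  constructor
  · intro h
    -- the closed set: reached inside `W`, or beyond `a₁` once `a₁` is reached inside `W`
    have key : u ∈ {t | Conn ends (withinRestr ends W x) r t ∨
        (Conn ends (withinRestr ends W x) r a₁ ∧ t ∈ W')} := by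
      refine mem_of_conn_of_closed (ends := ends) (ω := x) ?_ (Or.inl (conn_refl _ _ _)) h
      rintro t (ht | ⟨ha, htW'⟩) t' htt'
      · obtain ⟨_, e, he, hends⟩ := openGraph_adj.1 htt'
        by_cases hw : e ∈ within ends W
        · have he' : withinRestr ends W x e = true := by simp [withinRestr, hw, he]
          exact Or.inl (conn_trans ht (conn_of_openAdj ⟨e, he', hends⟩))
        · have hw' : e ∈ within ends W' := (hx e he).resolve_left hw
          have htW : t ∈ W := mem_of_conn_withinRestr ends hr ht
          have hmem := ends_mem_of_within ends hw' hends
          have hta : t = a₁ := hcap t htW hmem.1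
          exact Or.inr ⟨hta ▸ ht, hmem.2⟩
      · obtain ⟨_, e, he, hends⟩ := openGraph_adj.1 htt'
        by_cases hw' : e ∈ within ends W'
        · exact Or.inr ⟨ha, (ends_mem_of_within ends hw' hends).2⟩
        · have hw : e ∈ within ends W := (hx e he).resolve_right hw'
          have hmem := ends_mem_of_within ends hw hends
          have hta : t = a₁ := hcap t hmem.1 htW'
          have he' : withinRestr ends W x e = true := by simp [withinRestr, hw, he]
          exact Or.inl (conn_trans ha (hta ▸ conn_of_openAdj ⟨e, he', hends⟩))
    rcases key with h1 | ⟨ha, huW'⟩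
    · exact h1
    · have : u = a₁ := hcap u hu huW'
      exact this ▸ ha
  · exact fun h => conn_mono (withinRestr_le ends W x) h

/-- **Crossing the cut vertex**: a connection from `r ∈ W` to `u ∈ W' ∖ {a₁}` is a connection
from `r` to `a₁` inside `W` followed by one from `a₁` to `u` inside `W'`. -/
theorem conn_cross {W W' : Set V} {a₁ : V} {x : Config E}
    (hx : ∀ e, x e = true → e ∈ within ends W ∨ e ∈ within ends W')
    (hcap : ∀ t, t ∈ W → t ∈ W' → t = a₁) (ha1 : a₁ ∈ W ∧ a₁ ∈ W') {r u : V} (hr : r ∈ W)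
    (hu : u ∈ W') (hu1 : u ≠ a₁) :
    Conn ends x r u ↔
      Conn ends (withinRestr ends W x) r a₁ ∧ Conn ends (withinRestr ends W' x) a₁ u := by
  have hx' : ∀ e, x e = true → e ∈ within ends W' ∨ e ∈ within ends W := fun e he =>
    (hx e he).symm
  have hcap' : ∀ t, t ∈ W' → t ∈ W → t = a₁ := fun t h1 h2 => hcap t h2 h1
  constructor
  · intro h
    have key : u ∈ {t | Conn ends (withinRestr ends W x) r t ∨
        (Conn ends (withinRestr ends W x) r a₁ ∧ t ∈ W')} := by
      refine mem_of_conn_of_closed (ends := ends) (ω := x) ?_ (Or.inl (conn_refl _ _ _)) h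
      rintro t (ht | ⟨ha, htW'⟩) t' htt'
      · obtain ⟨_, e, he, hends⟩ := openGraph_adj.1 htt'
        by_cases hw : e ∈ within ends W
        · have he' : withinRestr ends W x e = true := by simp [withinRestr, hw, he]
          exact Or.inl (conn_trans ht (conn_of_openAdj ⟨e, he', hends⟩))
        · have hw' : e ∈ within ends W' := (hx e he).resolve_left hw
          have htW : t ∈ W := mem_of_conn_withinRestr ends hr ht
          have hmem := ends_mem_of_within ends hw' hends
          have hta : t = a₁ := hcap t htW hmem.1
          exact Or.inr ⟨hta ▸ ht, hmem.2⟩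
      · obtain ⟨_, e, he, hends⟩ := openGraph_adj.1 htt'
        by_cases hw' : e ∈ within ends W'
        · exact Or.inr ⟨ha, (ends_mem_of_within ends hw' hends).2⟩
        · have hw : e ∈ within ends W := (hx e he).resolve_right hw'
          have hmem := ends_mem_of_within ends hw hends
          have hta : t = a₁ := hcap t hmem.1 htW'
          have he' : withinRestr ends W x e = true := by simp [withinRestr, hw, he]
          exact Or.inl (conn_trans ha (hta ▸ conn_of_openAdj ⟨e, he', hends⟩))
    rcases key with h1 | ⟨ha, _⟩
    · exact absurd (hcap u (mem_of_conn_withinRestr ends hr h1) hu) hu1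
    · refine ⟨ha, ?_⟩
      have h2 : Conn ends x a₁ u :=
        conn_trans (conn_symm (conn_mono (withinRestr_le ends W x) ha)) h
      exact (conn_side ends hx' hcap' ha1.2 hu).1 h2
  · rintro ⟨h1, h2⟩
    exact conn_trans (conn_mono (withinRestr_le ends W x) h1)
      (conn_mono (withinRestr_le ends W' x) h2)

end Sides

/-! ## The class and the states of the support -/

section Support

open Classical

variable {V : Type*} {E : Type*} [Fintype E] [DecidableEq E]
variable (ends : E → Sym2 V) (o a₁ a₂ a₃ b : V)

/-- **The cut vertex at the root `a₁`**: the support graph `z ∪ F` splits into a side `VL ∋ o, b`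
and a side `VH ∋ a₂, a₃` meeting only in `a₁`, no typed edge inside both sides. -/
structure CutAtRoot (VL VH : Set V) (F : Finset E) (z : Config E) : Prop where
  split : ∀ e, zF F z e = true → e ∈ within ends VL ∨ e ∈ within ends VH
  cap : ∀ t, t ∈ VL → t ∈ VH → t = a₁
  noloop : ∀ e ∈ F, ¬ (e ∈ within ends VL ∧ e ∈ within ends VH)
  a1L : a₁ ∈ VL
  a1H : a₁ ∈ VH
  oL : o ∈ VL
  bL : b ∈ VL
  a2H : a₂ ∈ VH
  a3H : a₃ ∈ VH
  o1 : o ≠ a₁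
  b1 : b ≠ a₁
  a21 : a₂ ≠ a₁
  a31 : a₃ ≠ a₁

/-- The `h`-state of a configuration at a cut root: the set partition of `{a₂, a₁, a₃}` inside the
side `VH`. -/
noncomputable def hstC (VH : Set V) (y : Config E) : HState :=
  if Conn ends (withinRestr ends VH y) a₂ a₁ then
    (if Conn ends (withinRestr ends VH y) a₂ a₃ then HState.A else HState.C)
  else if Conn ends (withinRestr ends VH y) a₂ a₃ then HState.B
  else if Conn ends (withinRestr ends VH y) a₁ a₃ then HState.D else HState.E

omit [Fintype E] [DecidableEq E] in
/-- The coordinates of the `h`-state. -/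
lemma hstC_coords (VH : Set V) (y : Config E) :
    (hstC ends a₁ a₂ a₃ VH y).hv = decide (Conn ends (withinRestr ends VH y) a₂ a₁) ∧
    (hstC ends a₁ a₂ a₃ VH y).h3 = decide (Conn ends (withinRestr ends VH y) a₂ a₃) ∧
    (hstC ends a₁ a₂ a₃ VH y).v3 = decide (Conn ends (withinRestr ends VH y) a₁ a₃) := by
  unfold hstC
  by_cases h1 : Conn ends (withinRestr ends VH y) a₂ a₁ <;>
    by_cases h2 : Conn ends (withinRestr ends VH y) a₂ a₃ <;>
    by_cases h3 : Conn ends (withinRestr ends VH y) a₁ a₃ <;>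
    simp [h1, h2, h3, HState.hv, HState.h3, HState.v3]
  · exact h3 (conn_trans (conn_symm h1) h2)
  · exact h2 (conn_trans h1 h3)
  · exact h1 (conn_trans h2 (conn_symm h3))

omit [Fintype E] in
/-- A configuration below `z ∪ F` has its open edges within a side. -/
lemma split_of_le {VL VH : Set V} {F : Finset E} {z : Config E}
    (h : CutAtRoot ends o a₁ a₂ a₃ b VL VH F z) {x : Config E} (hx : x ≤ zF F z) :
    ∀ e, x e = true → e ∈ within ends VL ∨ e ∈ within ends VH := fun e he =>
  h.split e (by have := hx e; rw [he] at this; exact Bool.eq_true_of_true_le this)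

omit [Fintype E] in
/-- **The state of a copy of the support** at a cut root: the root-bridge state with the bridge
bit `true`. -/
theorem st_eq_cutSt {VL VH : Set V} {F : Finset E} {z : Config E}
    (h : CutAtRoot ends o a₁ a₂ a₃ b VL VH F z) {x : Config E} (hx : ∀ e, e ∉ F → x e = z e) :
    st ends o a₁ a₂ a₃ b x =
      brSt true (hstC ends a₁ a₂ a₃ VH x) (decide (Conn ends (withinRestr ends VL x) a₁ o))
        (decide (Conn ends (withinRestr ends VL x) a₁ b)) := by
  have hsp := split_of_le ends o a₁ a₂ a₃ b h (le_zF hx)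
  have hsp' : ∀ e, x e = true → e ∈ within ends VH ∨ e ∈ within ends VL := fun e he =>
    (hsp e he).symm
  have hcap' : ∀ t, t ∈ VH → t ∈ VL → t = a₁ := fun t h1 h2 => h.cap t h2 h1
  obtain ⟨hhv, hh3, hv3⟩ := hstC_coords ends a₁ a₂ a₃ VH x
  unfold st brSt
  rw [hhv, hh3, hv3]
  simp only [Bool.true_and]
  have e1 := conn_side ends hsp' hcap' h.a2H h.a1H
  have e2 := conn_side ends hsp h.cap h.a1L h.oL
  have e3 := conn_cross ends hsp' hcap' ⟨h.a1H, h.a1L⟩ h.a2H h.oL h.o1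
  have e4 := conn_side ends hsp h.cap h.a1L h.bL
  have e5 := conn_cross ends hsp' hcap' ⟨h.a1H, h.a1L⟩ h.a2H h.bL h.b1
  have e6 := conn_side ends hsp' hcap' h.a1H h.a3H
  have e7 := conn_side ends hsp' hcap' h.a2H h.a3H
  rw [decide_eq_decide.mpr e1, decide_eq_decide.mpr e2, decide_eq_decide.mpr e3,
    decide_eq_decide.mpr e4, decide_eq_decide.mpr e5, decide_eq_decide.mpr e6,
    decide_eq_decide.mpr e7]
  · simp only [Bool.decide_and]
  all_goals infer_instance

end Support

end RootBridge

end CovForm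

end Summit.Ventures.PercRepro2
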